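import Summits.KontsevichZagierPeriods.Zeta5Search.LaiSweepShard

/-!
# `κ₃` sweep certificate — shard file 097 of 127 (shards 679–685 of 889)

HONEST FRAMING. Systematic search; no irrationality claim unless certified. This file only checks,
by `decide +kernel`, shards 679–685 of the order-cell sweep of the `κ₃` point `(74, 2180, 444; δ74)`
(engine `LaiSweepEngine`, soundness `LaiSweepJump/Free/Eval/Shard/Kappa3`; a shard is `⟨regime, n,
p, q, p', q', Lo, Up⟩`: `n` cells from `p/q` to `p'/q'` with integer rate sums in `[Lo, Up]`, `K =
128`, `D = 2^40`). It draws NO conclusion: only the capstone `LaiKappa3SweepCert`, which needs all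
127 shard files, does. Kernel cost of this file ≈ 560 cells × 0.3 s.
-/

namespace Summit.KontsevichZagierPeriods.Zeta5Search.Sweep

set_option maxHeartbeats 100000000 in
/-- Shard 679: 80 cells of regime B from `307/417` to `250/339`.
[cite: Lai2024BallRivoal, §4 Lemma 4.3] -/
theorem shard679 :
    Shard.check 128 (2^40)
      ⟨true, 80, 307, 417, 250, 339, 11627527116843, 17144528821017⟩ = true := by
  decide +kernel

set_option maxHeartbeats 100000000 in
/-- Shard 680: 80 cells of regime B from `250/339` to `229/310`.
[cite: Lai2024BallRivoal, §4 Lemma 4.3] -/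
theorem shard680 :
    Shard.check 128 (2^40)
      ⟨true, 80, 250, 339, 229, 310, 11576231705990, 17086639404976⟩ = true := by
  decide +kernel

set_option maxHeartbeats 100000000 in
/-- Shard 681: 80 cells of regime B from `229/310` to `37/50`.
[cite: Lai2024BallRivoal, §4 Lemma 4.3] -/
theorem shard681 :
    Shard.check 128 (2^40)
      ⟨true, 80, 229, 310, 37, 50, 11966605660544, 17681673654153⟩ = true := by
  decide +kernel

set_option maxHeartbeats 100000000 in
/-- Shard 682: 80 cells of regime B from `37/50` to `3561/4804`.
[cite: Lai2024BallRivoal, §4 Lemma 4.3] -/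
theorem shard682 :
    Shard.check 128 (2^40)
      ⟨true, 80, 37, 50, 3561, 4804, 11641340021746, 17219415821660⟩ = true := by
  decide +kernel

set_option maxHeartbeats 100000000 in
/-- Shard 683: 80 cells of regime B from `3561/4804` to `173/233`.
[cite: Lai2024BallRivoal, §4 Lemma 4.3] -/
theorem shard683 :
    Shard.check 128 (2^40)
      ⟨true, 80, 3561, 4804, 173, 233, 11393422053285, 16870243930603⟩ = true := by
  decide +kernel

set_option maxHeartbeats 100000000 in
/-- Shard 684: 80 cells of regime B from `173/233` to `267/359`.
[cite: Lai2024BallRivoal, §4 Lemma 4.3] -/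
theorem shard684 :
    Shard.check 128 (2^40)
      ⟨true, 80, 173, 233, 267, 359, 11497312955141, 17041734806296⟩ = true := by
  decide +kernel

set_option maxHeartbeats 100000000 in
/-- Shard 685: 80 cells of regime B from `267/359` to `149/200`.
[cite: Lai2024BallRivoal, §4 Lemma 4.3] -/
theorem shard685 :
    Shard.check 128 (2^40)
      ⟨true, 80, 267, 359, 149, 200, 11707026451364, 17370803968615⟩ = true := by
  decide +kernel

/-- The checked shards of this file, in order. [folklore] -/
def shards097 : List (CheckedShard 128 (2^40)) :=
  [⟨_, shard679⟩, ⟨_, shard680⟩, ⟨_, shard681⟩, ⟨_, shard682⟩, ⟨_, shard683⟩,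
    ⟨_, shard684⟩, ⟨_, shard685⟩]

end Summit.KontsevichZagierPeriods.Zeta5Search.Sweep
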